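import Summits.RiemannHypothesis.RiemannHypothesis.Theorems.LiTailLaguerreDefs
import Summits.RiemannHypothesis.RiemannHypothesis.Theorems.LiPrimeEchoNonresonant
import Literature.Analysis.SpecialFunctions.DigammaLogBound
import HarnessLib

/-!
# RiemannHypothesis / LiTailLaguerre — crux K1′ `LiTailContour`, part 1: the CO-WEIGHT on the right edge and the
# integrability of the three tail pieces (RH-FREE)

RH-FREE [rh-li-eng g5; binder K1′ dealt by director-rh g6 15:25Z].  Round 7 of the LI column (theory g9, dossier
`HOME/theory/route/r7`, PART K = `Theorems/LiTailLaguerreDefs.lean`): the half-strip `[−1/2, 3/2] × [T, ∞)` version of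
Bombieri's rectangle.  This file supplies the analytic facts about the symmetrised CO-WEIGHT `2 − k_n(w)` on `Re w = 3/2`
that make the improper integrals `liPolarTail`, `liGammaTail`, `liPrimeTail` honest limits of the finite-rectangle pieces:

* `2 − k_n(3/2 + iy) = (1 − zⁿ)(1 − z⁻ⁿ)`, `z = 1 − 1/w` (`coSymWeight_rightPt`), hence
  `‖2 − k_n(3/2 + iy)‖ ≤ e·n²/y²` for `y ≥ √n`, `y > 0` (`|1 − zⁿ| ≤ n/|w|`, `|1 − z⁻ⁿ| ≤ n e/|w − 1|`);
* the polar, gamma and prime integrands of the right edge are continuous on `y ≥ 1` and `O_n(y^{−3/2})` beyond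
  `max(T, √n)`, hence integrable on `Ioi T` (`T ≥ 1`), and the finite pieces `∫_T^Y` converge to the tails as `Y → ∞`.

Nothing about zeros; nothing here bears on the truth of RH.
-/

noncomputable section

-- D-0017: `Summit.<S>.<S>.…` is the designed namespace of a single-problem summit.
set_option linter.dupNamespace false

open Complex MeasureTheory intervalIntegral Set Filter
open scoped Real Interval Topology ArithmeticFunction.vonMangoldt

namespace Summit.RiemannHypothesis.RiemannHypothesis.Theorems.LiTheory

open Literature.NumberTheory.LFunctions

namespace TailContour

open PrimeEdge

/-! ### The co-weight on the right edge -/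

/-- `2 − k_n(3/2 + iy) = (1 − zⁿ)(1 − z⁻ⁿ)`. -/
theorem coSymWeight_rightPt (n : ℕ) (y : ℝ) :
    liCoSymWeight n (liRightPt y) = (1 - zq y ^ n) * (1 - (zq y ^ n)⁻¹) := by
  rw [liCoSymWeight, liSymWeight_rightPt]
  have h0 : zq y ^ n ≠ 0 := pow_ne_zero _ (zq_ne_zero y)
  field_simp
  ring

/-- `2 − k_n` is continuous along the right edge. -/
theorem continuous_coSymWeight (n : ℕ) : Continuous fun y ↦ liCoSymWeight n (liRightPt y) := by
  unfold liCoSymWeight; exact continuous_const.sub (continuous_symWeight n)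

/-- `y ≤ ‖3/2 + iy‖` and `y ≤ ‖1/2 + iy‖` for `y ≥ 0`. -/
theorem le_norm_liRightPt {y : ℝ} (hy : 0 ≤ y) : y ≤ ‖liRightPt y‖ ∧ y ≤ ‖liRightPt y - 1‖ := by
  constructor
  · have h := norm_liRightPt_sq y
    nlinarith [norm_nonneg (liRightPt y)]
  · have h := norm_liRightPt_sub_one_sq y
    nlinarith [norm_nonneg (liRightPt y - 1)]

/-- `‖1 − zⁿ‖ ≤ n/y` on the right edge (`y > 0`). -/
theorem norm_one_sub_zq_pow_le (n : ℕ) {y : ℝ} (hy : 0 < y) : ‖1 - zq y ^ n‖ ≤ n / y := by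
  have hgeom := mul_neg_geom_sum (zq y) n
  have h1z : 1 - zq y = 1 / liRightPt y := by rw [zq]; ring
  rw [← hgeom, norm_mul, h1z]
  have hw : ‖1 / liRightPt y‖ ≤ 1 / y := by
    rw [norm_div, norm_one]
    exact one_div_le_one_div_of_le hy (le_norm_liRightPt hy.le).1
  have hsum : ‖∑ i ∈ Finset.range n, zq y ^ i‖ ≤ n := by
    calc ‖∑ i ∈ Finset.range n, zq y ^ i‖ ≤ ∑ i ∈ Finset.range n, ‖zq y ^ i‖ := norm_sum_le _ _
      _ ≤ ∑ _i ∈ Finset.range n, (1 : ℝ) := Finset.sum_le_sum fun i _ ↦ norm_zq_pow_le_one i y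
      _ = n := by simp
  calc ‖1 / liRightPt y‖ * ‖∑ i ∈ Finset.range n, zq y ^ i‖ ≤ 1 / y * n :=
        mul_le_mul hw hsum (norm_nonneg _) (by positivity)
    _ = n / y := by ring

/-- `‖1 − z⁻ⁿ‖ ≤ n e/y` on the right edge for `y ≥ √n`, `y > 0`. -/
theorem norm_one_sub_zq_pow_inv_le (n : ℕ) {y : ℝ} (hy : Real.sqrt n ≤ y) (hy0 : 0 < y) :
    ‖1 - (zq y ^ n)⁻¹‖ ≤ n * Real.exp 1 / y := by
  set u : ℂ := (zq y)⁻¹ with hu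
  have hun : (zq y ^ n)⁻¹ = u ^ n := by rw [hu, inv_pow]
  have hgeom := mul_neg_geom_sum u n
  have hz0 := zq_ne_zero y
  have h1u : 1 - u = -(1 / (liRightPt y - 1)) := by
    rw [hu, zq_eq_div, inv_div]
    have h1 := liRightPt_sub_one_ne_zero y
    field_simp
    ring
  have hu1 : 1 ≤ ‖u‖ := by
    rw [hu, norm_inv]
    exact one_le_inv_iff₀.2 ⟨norm_pos_iff.2 hz0, norm_zq_le_one y⟩
  have hun_le : ‖u ^ n‖ ≤ Real.exp 1 := by rw [← hun]; exact norm_zq_pow_inv_le n hy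
  rw [hun, ← hgeom, norm_mul, h1u, norm_neg]
  have hw : ‖1 / (liRightPt y - 1)‖ ≤ 1 / y := by
    rw [norm_div, norm_one]
    exact one_div_le_one_div_of_le hy0 (le_norm_liRightPt hy0.le).2
  have hsum : ‖∑ i ∈ Finset.range n, u ^ i‖ ≤ n * Real.exp 1 := by
    calc ‖∑ i ∈ Finset.range n, u ^ i‖ ≤ ∑ i ∈ Finset.range n, ‖u ^ i‖ := norm_sum_le _ _
      _ ≤ ∑ _i ∈ Finset.range n, Real.exp 1 := Finset.sum_le_sum fun i hi ↦ by
          rw [norm_pow]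
          calc ‖u‖ ^ i ≤ ‖u‖ ^ n := pow_le_pow_right₀ hu1 (Finset.mem_range.1 hi).le
            _ = ‖u ^ n‖ := (norm_pow _ _).symm
            _ ≤ Real.exp 1 := hun_le
      _ = n * Real.exp 1 := by simp
  calc ‖1 / (liRightPt y - 1)‖ * ‖∑ i ∈ Finset.range n, u ^ i‖ ≤ 1 / y * (n * Real.exp 1) :=
        mul_le_mul hw hsum (norm_nonneg _) (by positivity)
    _ = n * Real.exp 1 / y := by ring

/-- **The co-weight is `O(n²/y²)`**: `‖2 − k_n(3/2 + iy)‖ ≤ e n²/y²` for `y ≥ √n`, `y > 0`. -/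
theorem norm_coSymWeight_le (n : ℕ) {y : ℝ} (hy : Real.sqrt n ≤ y) (hy0 : 0 < y) :
    ‖liCoSymWeight n (liRightPt y)‖ ≤ Real.exp 1 * (n : ℝ) ^ 2 / y ^ 2 := by
  rw [coSymWeight_rightPt, norm_mul]
  calc ‖1 - zq y ^ n‖ * ‖1 - (zq y ^ n)⁻¹‖ ≤ (n / y) * (n * Real.exp 1 / y) :=
        mul_le_mul (norm_one_sub_zq_pow_le n hy0) (norm_one_sub_zq_pow_inv_le n hy hy0) (norm_nonneg _)
          (by positivity)
    _ = Real.exp 1 * (n : ℝ) ^ 2 / y ^ 2 := by ring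

/-! ### The three integrands of the right edge -/

/-- Polar integrand `(1/w + 1/(w − 1))(2 − k_n(w))`. -/
def polarIntegrand (n : ℕ) (y : ℝ) : ℂ := (1 / liRightPt y + 1 / (liRightPt y - 1)) * liCoSymWeight n (liRightPt y)

/-- Gamma integrand `(−½ log π + ½ ψ(w/2))(2 − k_n(w))`. -/
def gammaIntegrand (n : ℕ) (y : ℝ) : ℂ :=
  (-(Real.log Real.pi : ℂ) / 2 + 1 / 2 * Complex.digamma (liRightPt y / 2)) * liCoSymWeight n (liRightPt y)

/-- Prime integrand `L(Λ, w)(2 − k_n(w))`. -/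
def primeIntegrand (n : ℕ) (y : ℝ) : ℂ := LSeries (fun m ↦ (Λ m : ℂ)) (liRightPt y) * liCoSymWeight n (liRightPt y)

/-- `liPolarTail` is `(1/π) Re ∫_{Ioi T}` of the polar integrand. -/
theorem liPolarTail_eq (n : ℕ) (T : ℝ) : liPolarTail n T = 1 / Real.pi * (∫ y in Ioi T, polarIntegrand n y).re := rfl

/-- `liGammaTail` is `(1/π) Re ∫_{Ioi T}` of the gamma integrand. -/
theorem liGammaTail_eq (n : ℕ) (T : ℝ) : liGammaTail n T = 1 / Real.pi * (∫ y in Ioi T, gammaIntegrand n y).re := rfl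

/-- `liPrimeTail` is `(1/π) Re ∫_{Ioi T}` of the prime integrand. -/
theorem liPrimeTail_eq (n : ℕ) (T : ℝ) : liPrimeTail n T = 1 / Real.pi * (∫ y in Ioi T, primeIntegrand n y).re := rfl

/-- The polar integrand is continuous. -/
theorem continuous_polarIntegrand (n : ℕ) : Continuous (polarIntegrand n) := by
  unfold polarIntegrand
  refine Continuous.mul ?_ (continuous_coSymWeight n)
  exact (continuous_const.div continuous_liRightPt liRightPt_ne_zero).add
    (continuous_const.div (continuous_liRightPt.sub continuous_const) liRightPt_sub_one_ne_zero)

/-- The gamma integrand is continuous. -/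
theorem continuous_gammaIntegrand (n : ℕ) : Continuous (gammaIntegrand n) := by
  unfold gammaIntegrand
  refine Continuous.mul ?_ (continuous_coSymWeight n)
  refine continuous_iff_continuousAt.2 fun y ↦ ?_
  have hψ : ContinuousAt (fun y : ℝ ↦ Complex.digamma (liRightPt y / 2)) y :=
    (continuousAt_digamma_of_re_pos (by rw [Complex.div_ofNat_re, liRightPt_re]; norm_num)).comp
      (continuous_liRightPt.continuousAt.div_const 2)
  exact continuousAt_const.add (continuousAt_const.mul hψ)

/-- The prime integrand is continuous (absolute and uniform convergence of `L(Λ, w)` on `Re w = 3/2`). -/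
theorem continuous_primeIntegrand (n : ℕ) : Continuous (primeIntegrand n) := by
  unfold primeIntegrand
  refine Continuous.mul ?_ (continuous_coSymWeight n)
  have h := continuous_tsum (fun m ↦ continuous_term m) summable_norm_term (fun m y ↦ (norm_term_rightPt y m).le)
  exact h

/-- `‖L(Λ, 3/2 + iy)‖ ≤ Σ Λ(m) m^{−3/2}`. -/
theorem norm_LSeries_rightPt_le (y : ℝ) :
    ‖LSeries (fun m ↦ (Λ m : ℂ)) (liRightPt y)‖ ≤ ∑' m : ℕ, ‖LSeries.term (fun m ↦ (Λ m : ℂ)) (3 / 2 : ℂ) m‖ := by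
  unfold LSeries
  refine (norm_tsum_le_tsum_norm ?_).trans (le_of_eq (tsum_congr fun m ↦ norm_term_rightPt y m))
  exact summable_norm_term.congr fun m ↦ (norm_term_rightPt y m).symm

/-- `log(y + 4) ≤ 6√y` for `y ≥ 1`. -/
theorem log_add_four_le {y : ℝ} (hy : 1 ≤ y) : Real.log (y + 4) ≤ 6 * Real.sqrt y := by
  have h0 : 0 < Real.sqrt (y + 4) := Real.sqrt_pos.2 (by linarith)
  have h1 : Real.log (y + 4) = 2 * Real.log (Real.sqrt (y + 4)) := by
    rw [Real.log_sqrt (by linarith)]; ring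
  have h2 : Real.log (Real.sqrt (y + 4)) ≤ Real.sqrt (y + 4) - 1 := Real.log_le_sub_one_of_pos h0
  have h9 : Real.sqrt 9 = 3 := by
    rw [show (9 : ℝ) = 3 ^ 2 by norm_num]; exact Real.sqrt_sq (by norm_num)
  have h3 : Real.sqrt (y + 4) ≤ 3 * Real.sqrt y := by
    calc Real.sqrt (y + 4) ≤ Real.sqrt (9 * y) := Real.sqrt_le_sqrt (by linarith)
      _ = Real.sqrt 9 * Real.sqrt y := Real.sqrt_mul (by norm_num) y
      _ = 3 * Real.sqrt y := by rw [h9]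
  linarith

/-- **Tail bounds**: for `y ≥ max(1, √n)` each integrand is `≤ K_n · y^{−3/2}` in norm. -/
theorem norm_integrands_le (n : ℕ) {y : ℝ} (hy1 : 1 ≤ y) (hyn : Real.sqrt n ≤ y) :
    ‖polarIntegrand n y‖ ≤ 2 * Real.exp 1 * (n : ℝ) ^ 2 * y ^ (-(3 / 2 : ℝ)) ∧
    ‖gammaIntegrand n y‖ ≤ 8 * Real.exp 1 * (n : ℝ) ^ 2 * y ^ (-(3 / 2 : ℝ)) ∧
    ‖primeIntegrand n y‖ ≤
      (∑' m : ℕ, ‖LSeries.term (fun m ↦ (Λ m : ℂ)) (3 / 2 : ℂ) m‖) * Real.exp 1 * (n : ℝ) ^ 2 * y ^ (-(3 / 2 : ℝ)) := by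
  have hy0 : 0 < y := by linarith
  have hcow := norm_coSymWeight_le n hyn hy0
  have hcow0 : 0 ≤ Real.exp 1 * (n : ℝ) ^ 2 / y ^ 2 := by positivity
  -- `1/y² ≤ y^{-3/2}` and `√y/y² = y^{-3/2}` for `y ≥ 1`
  have hr2 : 1 / y ^ 2 ≤ y ^ (-(3 / 2 : ℝ)) := by
    rw [Real.rpow_neg hy0.le, one_div]
    apply inv_anti₀ (by positivity)
    calc y ^ (3 / 2 : ℝ) ≤ y ^ (2 : ℝ) := Real.rpow_le_rpow_of_exponent_le hy1 (by norm_num)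
      _ = y ^ 2 := by rw [← Real.rpow_natCast]; norm_num
  have hr3 : Real.sqrt y / y ^ 2 = y ^ (-(3 / 2 : ℝ)) := by
    rw [Real.sqrt_eq_rpow, Real.rpow_neg hy0.le, div_eq_mul_inv, ← Real.rpow_natCast,
      ← Real.rpow_neg hy0.le, ← Real.rpow_add hy0, ← Real.rpow_neg hy0.le]
    norm_num
  refine ⟨?_, ?_, ?_⟩
  · -- polar: `‖1/w + 1/(w−1)‖ ≤ 2/y ≤ 2`
    have hpol : ‖1 / liRightPt y + 1 / (liRightPt y - 1)‖ ≤ 2 := by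
      obtain ⟨h1, h2⟩ := le_norm_liRightPt hy0.le
      calc ‖1 / liRightPt y + 1 / (liRightPt y - 1)‖ ≤ ‖1 / liRightPt y‖ + ‖1 / (liRightPt y - 1)‖ := norm_add_le _ _
        _ ≤ 1 / y + 1 / y := by
            rw [norm_div, norm_div, norm_one]
            exact add_le_add (one_div_le_one_div_of_le hy0 h1) (one_div_le_one_div_of_le hy0 h2)
        _ ≤ 1 + 1 := by gcongr <;> rw [div_le_one hy0] <;> exact hy1
        _ = 2 := by norm_num
    unfold polarIntegrand
    rw [norm_mul]
    calc ‖1 / liRightPt y + 1 / (liRightPt y - 1)‖ * ‖liCoSymWeight n (liRightPt y)‖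
        ≤ 2 * (Real.exp 1 * (n : ℝ) ^ 2 / y ^ 2) := mul_le_mul hpol hcow (norm_nonneg _) (by norm_num)
      _ = 2 * Real.exp 1 * (n : ℝ) ^ 2 * (1 / y ^ 2) := by ring
      _ ≤ 2 * Real.exp 1 * (n : ℝ) ^ 2 * y ^ (-(3 / 2 : ℝ)) := by gcongr
  · -- gamma: `‖−log π/2 + ψ(w/2)/2‖ ≤ 8√y`
    have hψ : ‖-(Real.log Real.pi : ℂ) / 2 + 1 / 2 * Complex.digamma (liRightPt y / 2)‖ ≤ 8 * Real.sqrt y := by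
      have hwre : 0 < (liRightPt y / 2).re := by rw [Complex.div_ofNat_re, liRightPt_re]; norm_num
      have hwim : 1 / 2 ≤ |(liRightPt y / 2).im| := by
        rw [Complex.div_ofNat_im, liRightPt_im, abs_of_pos (by positivity)]; linarith
      have hwn : ‖liRightPt y / 2‖ ≤ y + 3 := by
        rw [norm_div, Complex.norm_two]
        have : ‖liRightPt y‖ ≤ 3 / 2 + y := by
          calc ‖liRightPt y‖ = ‖((3 / 2 : ℝ) : ℂ) + (y : ℂ) * I‖ := by rw [liRightPt]; push_cast; ring_nf
            _ ≤ ‖((3 / 2 : ℝ) : ℂ)‖ + ‖(y : ℂ) * I‖ := norm_add_le _ _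
            _ = 3 / 2 + y := by simp [abs_of_pos hy0]
        linarith
      have hd := norm_digamma_le_log_height hwre hwim hwn
      have hlogπ : ‖-(Real.log Real.pi : ℂ) / 2‖ ≤ 1 := by
        rw [norm_div, norm_neg, Complex.norm_real, Complex.norm_two, Real.norm_eq_abs,
          abs_of_nonneg (Real.log_nonneg (by linarith [Real.pi_gt_three]))]
        have : Real.log Real.pi ≤ 2 := by
          rw [Real.log_le_iff_le_exp Real.pi_pos]
          have h4 : Real.exp 2 = Real.exp 1 * Real.exp 1 := by rw [← Real.exp_add]; norm_num
          rw [h4]; nlinarith [Real.exp_one_gt_d9, Real.pi_lt_four]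
        linarith
      have hlog := log_add_four_le hy1
      have hs1 : 1 ≤ Real.sqrt y := by rw [← Real.sqrt_one]; exact Real.sqrt_le_sqrt hy1
      calc ‖-(Real.log Real.pi : ℂ) / 2 + 1 / 2 * Complex.digamma (liRightPt y / 2)‖
          ≤ ‖-(Real.log Real.pi : ℂ) / 2‖ + ‖(1 / 2 : ℂ) * Complex.digamma (liRightPt y / 2)‖ := norm_add_le _ _
        _ ≤ 1 + 1 / 2 * (Real.log (y + 4) + 8) := by
            rw [norm_mul]; gcongr; simp
        _ ≤ 8 * Real.sqrt y := by linarith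
    unfold gammaIntegrand
    rw [norm_mul]
    calc ‖-(Real.log Real.pi : ℂ) / 2 + 1 / 2 * Complex.digamma (liRightPt y / 2)‖ * ‖liCoSymWeight n (liRightPt y)‖
        ≤ (8 * Real.sqrt y) * (Real.exp 1 * (n : ℝ) ^ 2 / y ^ 2) := mul_le_mul hψ hcow (norm_nonneg _) (by positivity)
      _ = 8 * Real.exp 1 * (n : ℝ) ^ 2 * (Real.sqrt y / y ^ 2) := by ring
      _ = 8 * Real.exp 1 * (n : ℝ) ^ 2 * y ^ (-(3 / 2 : ℝ)) := by rw [hr3]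
  · unfold primeIntegrand
    rw [norm_mul]
    set S : ℝ := ∑' m : ℕ, ‖LSeries.term (fun m ↦ (Λ m : ℂ)) (3 / 2 : ℂ) m‖ with hS
    have hS0 : 0 ≤ S := tsum_nonneg fun _ ↦ norm_nonneg _
    calc ‖LSeries (fun m ↦ (Λ m : ℂ)) (liRightPt y)‖ * ‖liCoSymWeight n (liRightPt y)‖
        ≤ S * (Real.exp 1 * (n : ℝ) ^ 2 / y ^ 2) :=
          mul_le_mul (norm_LSeries_rightPt_le y) hcow (norm_nonneg _) hS0
      _ = S * Real.exp 1 * (n : ℝ) ^ 2 * (1 / y ^ 2) := by ring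
      _ ≤ S * Real.exp 1 * (n : ℝ) ^ 2 * y ^ (-(3 / 2 : ℝ)) := by gcongr

/-- A continuous function which is `≤ K y^{−3/2}` beyond `Y₀ ≥ T` is integrable on `Ioi T` (`T > 0`). -/
theorem integrableOn_Ioi_of_tail {f : ℝ → ℂ} (hf : Continuous f) {T Y₀ K : ℝ} (hT : 0 < T) (hY : T ≤ Y₀)
    (hb : ∀ y, Y₀ < y → ‖f y‖ ≤ K * y ^ (-(3 / 2 : ℝ))) : IntegrableOn f (Ioi T) := by
  have hY0 : 0 < Y₀ := hT.trans_le hY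
  have h1 : IntegrableOn f (Ioc T Y₀) :=
    (hf.continuousOn.integrableOn_Icc (a := T) (b := Y₀)).mono_set Ioc_subset_Icc_self
  have h2 : IntegrableOn f (Ioi Y₀) := by
    have hg : IntegrableOn (fun y : ℝ ↦ K * y ^ (-(3 / 2 : ℝ))) (Ioi Y₀) :=
      ((integrableOn_Ioi_rpow_of_lt (by norm_num) hY0).const_mul K)
    refine MeasureTheory.Integrable.mono' hg (hf.continuousOn.aestronglyMeasurable measurableSet_Ioi) ?_
    exact (ae_restrict_iff' measurableSet_Ioi).2 (Filter.Eventually.of_forall fun y hy ↦ hb y hy)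
  have hunion : Ioi T = Ioc T Y₀ ∪ Ioi Y₀ := (Ioc_union_Ioi_eq_Ioi hY).symm
  rw [hunion]
  exact h1.union h2

/-- **The three right-edge pieces are integrable on `Ioi T`** (`T ≥ 1`). -/
theorem integrableOn_integrands (n : ℕ) {T : ℝ} (hT : 1 ≤ T) :
    IntegrableOn (polarIntegrand n) (Ioi T) ∧ IntegrableOn (gammaIntegrand n) (Ioi T) ∧
      IntegrableOn (primeIntegrand n) (Ioi T) := by
  have hT0 : 0 < T := by linarith
  set Y₀ : ℝ := max T (Real.sqrt n) with hY₀
  have hY : T ≤ Y₀ := le_max_left _ _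
  have hb : ∀ y, Y₀ < y → 1 ≤ y ∧ Real.sqrt n ≤ y := fun y hy ↦
    ⟨hT.trans (hY.trans hy.le), (le_max_right _ _).trans hy.le⟩
  refine ⟨integrableOn_Ioi_of_tail (continuous_polarIntegrand n) (K := 2 * Real.exp 1 * (n : ℝ) ^ 2) hT0 hY
      fun y hy ↦ ?_,
    integrableOn_Ioi_of_tail (continuous_gammaIntegrand n) (K := 8 * Real.exp 1 * (n : ℝ) ^ 2) hT0 hY fun y hy ↦ ?_,
    integrableOn_Ioi_of_tail (continuous_primeIntegrand n)
      (K := (∑' m : ℕ, ‖LSeries.term (fun m ↦ (Λ m : ℂ)) (3 / 2 : ℂ) m‖) * Real.exp 1 * (n : ℝ) ^ 2) hT0 hY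
      fun y hy ↦ ?_⟩
  · exact (norm_integrands_le n (hb y hy).1 (hb y hy).2).1
  · exact (norm_integrands_le n (hb y hy).1 (hb y hy).2).2.1
  · exact (norm_integrands_le n (hb y hy).1 (hb y hy).2).2.2

/-- **The finite right-edge pieces converge to the tails**: along any `b → ∞`,
`(1/π) Re ∫_T^{b k} f → (1/π) Re ∫_{Ioi T} f` for each of the three integrands (`T ≥ 1`). -/
theorem tendsto_pieces (n : ℕ) {T : ℝ} (hT : 1 ≤ T) {b : ℕ → ℝ} (hb : Tendsto b atTop atTop) :
    Tendsto (fun k ↦ 1 / Real.pi * (∫ y in T..b k, polarIntegrand n y).re) atTop (𝓝 (liPolarTail n T)) ∧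
    Tendsto (fun k ↦ 1 / Real.pi * (∫ y in T..b k, gammaIntegrand n y).re) atTop (𝓝 (liGammaTail n T)) ∧
    Tendsto (fun k ↦ 1 / Real.pi * (∫ y in T..b k, primeIntegrand n y).re) atTop (𝓝 (liPrimeTail n T)) := by
  obtain ⟨hP, hG, hPr⟩ := integrableOn_integrands n hT
  have key : ∀ {f : ℝ → ℂ}, IntegrableOn f (Ioi T) →
      Tendsto (fun k ↦ 1 / Real.pi * (∫ y in T..b k, f y).re) atTop (𝓝 (1 / Real.pi * (∫ y in Ioi T, f y).re)) := by
    intro f hf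
    have h := MeasureTheory.intervalIntegral_tendsto_integral_Ioi T hf hb
    exact ((Complex.continuous_re.tendsto _).comp h).const_mul _
  exact ⟨liPolarTail_eq n T ▸ key hP, liGammaTail_eq n T ▸ key hG, liPrimeTail_eq n T ▸ key hPr⟩

end TailContour

end Summit.RiemannHypothesis.RiemannHypothesis.Theorems.LiTheory

end
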